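import Summits.CriticalPhenomena.PercolationContinuityZ3.Theorems.Transplant.PlanarSkeletonSignDefs
import Mathlib.GroupTheory.SemidirectProduct
import HarnessLib

/-!
# The Hantzsche–Wendt group `P2₁2₁2₁ = ⟨α, β | βα²β⁻¹ = α⁻², αβ²α⁻¹ = β⁻²⟩` (first Betti number ZERO) inside the signed affine group of `ℤ³`:
# its sign-twisted planar COCYCLE chart `φ(gh) = φ g + ε(g) • φ h` and the two conjugations realising `−I` and `diag(1,−1)` — the group-theoretic
# half (I of II) of the first `b₁ = 0` customer of the closed `(ℤ/2)²` node (memo §42)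

builds on p205010 (kernel theorem, internal audit signed; external expert review pending) — nothing in this file uses p205010; this file is pure
group theory (no percolation statement).  Lane `prim-bschramm`, seat `prim-bschramm-p4` (gen 20; PART C3, `HOME/bschramm/P4-GENERAL.md` §42).
Helper file (`--supports stmt-CriticalPhenomena-4575 --as helper`); consumed by `CayleyHantzscheWendtParity` and `CayleyHantzscheWendt` (the
`CayleyTwist` instance and `θ(p_c) = 0` on `Cay(HW; α^{±1}, β^{±1})`, through `PlanarSkeletonTwistedFrames`).

MODEL (coordinates doubled so that everything is integral).  `P := ℤ³ ⋊ {±1}³` (Mathlib `SemidirectProduct`; `(v, D) ↔ x ↦ D x + v`, `D` a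
diagonal sign matrix); `α := ((1,1,0), diag(1,−1,−1))`, `β := ((0,1,1), diag(−1,1,−1))` — the two screw motions generating the orientable flat
3-manifold group with holonomy `(ℤ/2)²` (Hantzsche–Wendt; space group `P2₁2₁2₁`, No. 19); `HW := closure {α, α⁻¹, β, β⁻¹} ≤ P`.
* §1 the ambient group `P`, `mk v D`, `tr`, product / inverse formulas;
* §2 `α`, `β`, the subgroup `HW`, the symmetric alphabet (as a set of `P`);
* §3 the CHART `chart (v, D) := (v₀, v₁ − δ(D₁))` (`δ(1) = 0`, `δ(−1) = 1`; = `2π_{xy}(g·x₀ − x₀)` for the base point `x₀ = (0, ½, ·)` on a 2-fold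
  axis) and the sign character `sgn (v, D) := (D₀, D₁)`: **the cocycle law `chart (g h) = chart g + sgn g • chart h` on all of `P`** (`chart_mul`);
  `chart α^{±1} = ±e₀`, `chart β^{±1} = ±e₁`;
* §4 the involutions `γ := ((0,1,0), diag(−1,−1,1))`, `γ′ := ((0,1,0), diag(1,−1,1))`: `γαγ = α⁻¹`, `γβγ = β⁻¹`, `γ′αγ′ = α`, `γ′βγ′ = β⁻¹`,
  **`chart (γ g γ) = −chart g`, `chart (γ′ g γ′) = flipSnd (chart g)`** on all of `P`; both conjugations preserve `HW` (`conjEquiv`);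
(Sequel `CayleyHantzscheWendtParity`: the parity invariant of the elements of `HW`, the fibre over the base value, and `Hom(HW, ℤ) = 0`.)
(R-level, not typed: `Cay(HW; α^{±1}, β^{±1})` is the diamond net — coordination sequence `4,12,24,42,64,92,124,162,204,252`, orbit of `x₀` =
two cosets of the body-centred lattice; cf. Conway–Sloane.)
[cite: ConwaySloane1999, Ch. 4 §6.1 (the diamond packing as a union of two cosets)] [cite: BenjaminiSchramm1996, §2 (Cayley graphs)]
-/

noncomputable section

namespace Summit.CriticalPhenomena.PercolationContinuityZ3.Theorems.Transplant

open Literature.Probability.LatticeModels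
open scoped Classical

namespace HW

/-! ## §1 The signed affine group `P = ℤ³ ⋊ {±1}³` -/

/-- Sign vectors `D ∈ {±1}³` (diagonal sign matrices). [folklore] -/
abbrev K3 : Type := Fin 3 → ℤˣ

/-- The sign change `v ↦ (D₀ v₀, D₁ v₁, D₂ v₂)` as an additive automorphism of `ℤ³`. [folklore] -/
def sgnAut (D : K3) : Site 3 ≃+ Site 3 where
  toFun v := fun i => (D i : ℤ) * v i
  invFun v := fun i => (D i : ℤ) * v i
  left_inv v := by funext i; simp [← mul_assoc]
  right_inv v := by funext i; simp [← mul_assoc]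
  map_add' x y := by funext i; simp [mul_add]

/-- Coordinates of `sgnAut`. [folklore] -/
@[simp] theorem sgnAut_apply (D : K3) (v : Site 3) (i : Fin 3) : sgnAut D v i = (D i : ℤ) * v i := rfl

/-- The action `{±1}³ → Aut(ℤ³)` (multiplicative form). [folklore] -/
def act : K3 →* MulAut (Multiplicative (Site 3)) where
  toFun D := AddEquiv.toMultiplicative (sgnAut D)
  map_one' := by
    ext v i
    show ((1 : K3) i : ℤ) * v.toAdd i = v.toAdd i
    simp
  map_mul' D E := by
    ext v i
    show ((D * E) i : ℤ) * v.toAdd i = (D i : ℤ) * ((E i : ℤ) * v.toAdd i)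
    simp [mul_assoc]

/-- `act D` is `sgnAut D` on additive coordinates. [folklore] -/
@[simp] theorem toAdd_act (D : K3) (n : Multiplicative (Site 3)) : (act D n).toAdd = sgnAut D n.toAdd := rfl

/-- **The signed affine group of `ℤ³`**: `P = ℤ³ ⋊ {±1}³`, `(v, D) ↔ (x ↦ D x + v)`. [folklore] -/
abbrev P : Type := Multiplicative (Site 3) ⋊[act] K3

/-- The element `x ↦ D x + v`. [folklore] -/
def mk (v : Site 3) (D : K3) : P := ⟨Multiplicative.ofAdd v, D⟩

/-- The translation part. [folklore] -/
def tr (g : P) : Site 3 := g.left.toAdd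

/-- `tr (mk v D) = v`. [folklore] -/
@[simp] theorem tr_mk (v : Site 3) (D : K3) : tr (mk v D) = v := rfl

/-- `(mk v D).right = D`. [folklore] -/
@[simp] theorem mk_right (v : Site 3) (D : K3) : (mk v D).right = D := rfl

/-- Every element is `mk (tr g) g.right`. [folklore] -/
theorem mk_tr_right (g : P) : mk (tr g) g.right = g := rfl

/-- Translation part of a product: `v_g + D_g v_h`. [folklore] -/
theorem tr_mul (g h : P) : tr (g * h) = tr g + sgnAut g.right (tr h) := by
  show (g.left * act g.right h.left).toAdd = _
  rw [toAdd_mul, toAdd_act]; rfl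

/-- Sign part of a product. [folklore] -/
theorem right_mul (g h : P) : (g * h).right = g.right * h.right := rfl

/-- Product formula. [folklore] -/
theorem mk_mul_mk (v w : Site 3) (D E : K3) : mk v D * mk w E = mk (v + sgnAut D w) (D * E) :=
  SemidirectProduct.ext rfl rfl

/-- Sign vectors are involutions. [folklore] -/
theorem sgn_mul_self (D : K3) : D * D = 1 := by
  funext i; simp [Int.units_mul_self]

/-- Inverse formula. [folklore] -/
theorem mk_inv (v : Site 3) (D : K3) : (mk v D)⁻¹ = mk (-sgnAut D v) D := by
  rw [inv_eq_iff_mul_eq_one, mk_mul_mk]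
  refine SemidirectProduct.ext ?_ (sgn_mul_self D)
  show Multiplicative.ofAdd (v + sgnAut D (-sgnAut D v)) = Multiplicative.ofAdd 0
  congr 1; funext i; simp [← mul_assoc]

/-- Sign vectors are their own inverses. [folklore] -/
theorem sgn_inv_eq (D : K3) : D⁻¹ = D :=
  inv_eq_of_mul_eq_one_right (sgn_mul_self D)

/-- Translation part of an inverse. [folklore] -/
theorem tr_inv (g : P) : tr g⁻¹ = -sgnAut g.right (tr g) := by
  show (act g.right⁻¹ g.left⁻¹).toAdd = _
  rw [toAdd_act, toAdd_inv, sgn_inv_eq, map_neg]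
  rfl

/-- Sign part of an inverse. [folklore] -/
theorem inv_right_eq (g : P) : g⁻¹.right = g.right := by
  show g.right⁻¹ = g.right
  exact sgn_inv_eq _

/-! ## §2 The generators, the Hantzsche–Wendt subgroup, the symmetric alphabet -/

/-- The screw `α : x ↦ diag(1,−1,−1) x + (1,1,0)` (half-turn about an `x`-parallel axis, then translate). [folklore] -/
def α : P := mk ![1, 1, 0] ![1, -1, -1]

/-- The screw `β : x ↦ diag(−1,1,−1) x + (0,1,1)`. [folklore] -/
def β : P := mk ![0, 1, 1] ![-1, 1, -1]

/-- The symmetric alphabet `{α, α⁻¹, β, β⁻¹}` as a set of `P`. [folklore] -/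
def gens : Set P := {α, α⁻¹, β, β⁻¹}

/-- **The Hantzsche–Wendt group** `HW := ⟨α, β⟩ ≤ P`. [cite: ConwaySloane1999, Ch. 4 §6.1] -/
def Grp : Subgroup P := Subgroup.closure gens

/-- `α ∈ HW`. [folklore] -/
theorem α_mem : α ∈ Grp := Subgroup.subset_closure (by simp [gens])

/-- `β ∈ HW`. [folklore] -/
theorem β_mem : β ∈ Grp := Subgroup.subset_closure (by simp [gens])

/-- The generator `α` as an element of `HW`. [folklore] -/
def a : Grp := ⟨α, α_mem⟩

/-- The generator `β` as an element of `HW`. [folklore] -/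
def b : Grp := ⟨β, β_mem⟩

/-- The relation `β α² β⁻¹ = α⁻²`. [folklore] -/
theorem rel₁ : β * α * α * β⁻¹ = (α * α)⁻¹ := by
  simp only [α, β, mk_mul_mk, mk_inv]
  refine congrArg₂ mk ?_ ?_ <;> funext i <;> fin_cases i <;> simp <;> decide

/-- The relation `α β² α⁻¹ = β⁻²`. [folklore] -/
theorem rel₂ : α * β * β * α⁻¹ = (β * β)⁻¹ := by
  simp only [α, β, mk_mul_mk, mk_inv]
  refine congrArg₂ mk ?_ ?_ <;> funext i <;> fin_cases i <;> simp <;> decide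

/-! ## §3 The cocycle chart and the sign character -/

/-- `δ(1) = 0`, `δ(−1) = 1` (the half-integer offset of the base point, doubled). [folklore] -/
def δ (u : ℤˣ) : ℤ := if u = 1 then 0 else 1

/-- `δ 1 = 0`. [folklore] -/
@[simp] theorem δ_one : δ 1 = 0 := by decide

/-- `δ (−1) = 1`. [folklore] -/
@[simp] theorem δ_neg_one : δ (-1) = 1 := by decide

/-- **The planar chart** `chart (v, D) := (v₀, v₁ − δ(D₁))` — twice the `xy`-displacement of the base point `x₀ = (0, ½, z₀)` under `x ↦ D x + v`
(in halved coordinates). [cite: KozmaNitzan2024, §4 p. 15 (the coordinate map)] -/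
def chart (g : P) : Site 2 := ![tr g 0, tr g 1 - δ (g.right 1)]

/-- **The sign character** `sgn (v, D) := (D₀, D₁)` (holonomy on the two chart axes). [folklore] -/
def sgn : P →* (Fin 2 → ℤˣ) where
  toFun g := fun i => g.right (Fin.castSucc i)
  map_one' := rfl
  map_mul' _ _ := rfl

/-- `sgn g 0 = D₀`. [folklore] -/
@[simp] theorem sgn_apply_zero (g : P) : sgn g 0 = g.right 0 := rfl

/-- `sgn g 1 = D₁`. [folklore] -/
@[simp] theorem sgn_apply_one (g : P) : sgn g 1 = g.right 1 := rfl

/-- `δ` is a cocycle: `δ(u u') = δ u + u δ u'`. [folklore] -/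
theorem δ_mul (u u' : ℤˣ) : δ (u * u') = δ u + (u : ℤ) * δ u' := by
  rcases Int.units_eq_one_or u with rfl | rfl <;> rcases Int.units_eq_one_or u' with rfl | rfl <;> decide

/-- **THE COCYCLE LAW** `chart (g h) = chart g + sgn g • chart h` (a homomorphism `P → (ℤ ⋊ ℤˣ)²`).
[cite: KozmaNitzan2024, §4 p. 16 (Lemma 8: the lattice symmetries)] -/
theorem chart_mul (g h : P) : chart (g * h) = chart g + fun i => (sgn g i : ℤ) * chart h i := by
  funext i
  fin_cases i
  · simp [chart, tr_mul]
  · simp [chart, tr_mul, δ_mul]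
    ring

/-- `chart 1 = 0`. [folklore] -/
@[simp] theorem chart_one : chart 1 = 0 := by decide

/-- `chart α = e₀`. [folklore] -/
theorem chart_α : chart α = Pi.single 0 1 := by decide

/-- `chart α⁻¹ = −e₀`. [folklore] -/
theorem chart_α_inv : chart α⁻¹ = Pi.single 0 (-1) := by rw [α, mk_inv]; decide

/-- `chart β = e₁`. [folklore] -/
theorem chart_β : chart β = Pi.single 1 1 := by decide

/-- `chart β⁻¹ = −e₁`. [folklore] -/
theorem chart_β_inv : chart β⁻¹ = Pi.single 1 (-1) := by rw [β, mk_inv]; decide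

/-- The generators have sup-norm `≤ 1` in the chart. [folklore] -/
theorem chart_gens_le {s : P} (hs : s ∈ gens) (i : Fin 2) : |chart s i| ≤ 1 := by
  simp only [gens, Set.mem_insert_iff, Set.mem_singleton_iff] at hs
  rcases hs with rfl | rfl | rfl | rfl
  · rw [chart_α]; fin_cases i <;> decide
  · rw [chart_α_inv]; fin_cases i <;> decide
  · rw [chart_β]; fin_cases i <;> decide
  · rw [chart_β_inv]; fin_cases i <;> decide

/-! ## §4 The two involutions of the normaliser: `−I` and `diag(1,−1)` on the chart -/

/-- The half-turn `γ : x ↦ diag(−1,−1,1) x + (0,1,0)` (fixes the base point). [folklore] -/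
def γ : P := mk ![0, 1, 0] ![-1, -1, 1]

/-- The reflection `γ′ : x ↦ diag(1,−1,1) x + (0,1,0)` (fixes the base point). [folklore] -/
def γ' : P := mk ![0, 1, 0] ![1, -1, 1]

/-- `γ` is an involution. [folklore] -/
theorem γ_mul_γ : γ * γ = 1 := by
  simp only [γ, mk_mul_mk]
  refine SemidirectProduct.ext ?_ ?_
  · show Multiplicative.ofAdd _ = Multiplicative.ofAdd 0
    congr 1; funext i; fin_cases i <;> decide
  · funext i; fin_cases i <;> decide

/-- `γ′` is an involution. [folklore] -/
theorem γ'_mul_γ' : γ' * γ' = 1 := by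
  simp only [γ', mk_mul_mk]
  refine SemidirectProduct.ext ?_ ?_
  · show Multiplicative.ofAdd _ = Multiplicative.ofAdd 0
    congr 1; funext i; fin_cases i <;> decide
  · funext i; fin_cases i <;> decide

/-- `γ⁻¹ = γ`. [folklore] -/
theorem γ_inv : γ⁻¹ = γ := inv_eq_of_mul_eq_one_right γ_mul_γ

/-- `γ′⁻¹ = γ′`. [folklore] -/
theorem γ'_inv : γ'⁻¹ = γ' := inv_eq_of_mul_eq_one_right γ'_mul_γ'

/-- `γ α γ = α⁻¹`. [folklore] -/
theorem γ_α : γ * α * γ = α⁻¹ := by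
  simp only [α, γ, mk_mul_mk, mk_inv]
  refine congrArg₂ mk ?_ ?_ <;> funext i <;> fin_cases i <;> simp <;> decide

/-- `γ β γ = β⁻¹`. [folklore] -/
theorem γ_β : γ * β * γ = β⁻¹ := by
  simp only [β, γ, mk_mul_mk, mk_inv]
  refine congrArg₂ mk ?_ ?_ <;> funext i <;> fin_cases i <;> simp <;> decide

/-- `γ′ α γ′ = α`. [folklore] -/
theorem γ'_α : γ' * α * γ' = α := by
  simp only [α, γ', mk_mul_mk]
  refine congrArg₂ mk ?_ ?_ <;> funext i <;> fin_cases i <;> simp <;> decide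

/-- `γ′ β γ′ = β⁻¹`. [folklore] -/
theorem γ'_β : γ' * β * γ' = β⁻¹ := by
  simp only [β, γ', mk_mul_mk, mk_inv]
  refine congrArg₂ mk ?_ ?_ <;> funext i <;> fin_cases i <;> simp <;> decide

/-- `chart γ = 0` (γ fixes the base point). [folklore] -/
theorem chart_γ : chart γ = 0 := by decide

/-- `chart γ′ = 0`. [folklore] -/
theorem chart_γ' : chart γ' = 0 := by decide

/-- `sgn γ = (−1, −1)` acts as `−I`. [folklore] -/
theorem sgn_γ_smul (x : Site 2) : (fun i => (sgn γ i : ℤ) * x i) = -x := by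
  funext i; fin_cases i <;> simp [sgn, γ, mk]

/-- `sgn γ′ = (1, −1)` acts as `flipSnd`. [folklore] -/
theorem sgn_γ'_smul (x : Site 2) : (fun i => (sgn γ' i : ℤ) * x i) = flipSnd x := by
  funext i; fin_cases i <;> simp [sgn, γ', mk, flipSnd]

/-- **`γ` acts on the chart by `−I`**: `chart (γ g γ) = −chart g` for every `g ∈ P`. [cite: KozmaNitzan2024, §4 p. 16 (Lemma 8)] -/
theorem chart_conj_γ (g : P) : chart (γ * g * γ) = -chart g := by
  rw [chart_mul, chart_mul, chart_γ, zero_add, sgn_γ_smul]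
  funext i; simp

/-- **`γ′` acts on the chart by `diag(1,−1)`**: `chart (γ′ g γ′) = flipSnd (chart g)`. [cite: KozmaNitzan2024, §4 p. 16 (Lemma 8)] -/
theorem chart_conj_γ' (g : P) : chart (γ' * g * γ') = flipSnd (chart g) := by
  rw [chart_mul, chart_mul, chart_γ', zero_add, sgn_γ'_smul]
  funext i; simp

/-- An involution `c` of `P` with `c·gens·c = gens` conjugates `HW` into itself. [folklore] -/
theorem conj_mem {c : P} (hc : c * c = 1) (hgen : ∀ s ∈ gens, c * s * c ∈ gens) {g : P} (hg : g ∈ Grp) : c * g * c ∈ Grp := by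
  induction hg using Subgroup.closure_induction with
  | mem s hs => exact Subgroup.subset_closure (hgen s hs)
  | one => rw [mul_one, hc]; exact one_mem _
  | mul x y _ _ hx hy =>
    have e : c * (x * y) * c = (c * x * c) * (c * y * c) := by
      rw [show c * x * c * (c * y * c) = c * x * (c * c) * y * c by group, hc]; group
    rw [e]; exact mul_mem hx hy
  | inv x _ hx =>
    have e : c * x⁻¹ * c = (c * x * c)⁻¹ := by
      rw [mul_inv_rev, mul_inv_rev, inv_eq_of_mul_eq_one_right hc]; group
    rw [e]; exact inv_mem hx

/-- **Conjugation by an involution of the normaliser, as an automorphism of `HW`.** [folklore] -/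
def conjEquiv (c : P) (hc : c * c = 1) (hgen : ∀ s ∈ gens, c * s * c ∈ gens) : Grp ≃* Grp where
  toFun g := ⟨c * g * c, conj_mem hc hgen g.2⟩
  invFun g := ⟨c * g * c, conj_mem hc hgen g.2⟩
  left_inv g := Subtype.ext (by
    show c * (c * g * c) * c = g
    rw [show c * (c * (g : P) * c) * c = (c * c) * g * (c * c) by group, hc]; group)
  right_inv g := Subtype.ext (by
    show c * (c * g * c) * c = g
    rw [show c * (c * (g : P) * c) * c = (c * c) * g * (c * c) by group, hc]; group)
  map_mul' g h := Subtype.ext (by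
    show c * (g * h) * c = (c * g * c) * (c * h * c)
    rw [show c * (g : P) * c * (c * h * c) = c * g * (c * c) * h * c by group, hc]; group)

/-- `conjEquiv c` acts by `g ↦ c g c`. [folklore] -/
@[simp] theorem coe_conjEquiv (c : P) (hc : c * c = 1) (hgen : ∀ s ∈ gens, c * s * c ∈ gens) (g : Grp) :
    ((conjEquiv c hc hgen g : Grp) : P) = c * g * c := rfl

/-- `γ` normalises the alphabet. [folklore] -/
theorem γ_gens : ∀ s ∈ gens, γ * s * γ ∈ gens := by
  intro s hs
  simp only [gens, Set.mem_insert_iff, Set.mem_singleton_iff] at hs ⊢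
  rcases hs with rfl | rfl | rfl | rfl
  · exact Or.inr (Or.inl γ_α)
  · refine Or.inl ?_
    rw [show γ * α⁻¹ * γ = (γ⁻¹ * α * γ⁻¹)⁻¹ by group, γ_inv, γ_α, inv_inv]
  · exact Or.inr (Or.inr (Or.inr γ_β))
  · refine Or.inr (Or.inr (Or.inl ?_))
    rw [show γ * β⁻¹ * γ = (γ⁻¹ * β * γ⁻¹)⁻¹ by group, γ_inv, γ_β, inv_inv]

/-- `γ′` normalises the alphabet. [folklore] -/
theorem γ'_gens : ∀ s ∈ gens, γ' * s * γ' ∈ gens := by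
  intro s hs
  simp only [gens, Set.mem_insert_iff, Set.mem_singleton_iff] at hs ⊢
  rcases hs with rfl | rfl | rfl | rfl
  · exact Or.inl γ'_α
  · refine Or.inr (Or.inl ?_)
    rw [show γ' * α⁻¹ * γ' = (γ'⁻¹ * α * γ'⁻¹)⁻¹ by group, γ'_inv, γ'_α]
  · exact Or.inr (Or.inr (Or.inr γ'_β))
  · refine Or.inr (Or.inr (Or.inl ?_))
    rw [show γ' * β⁻¹ * γ' = (γ'⁻¹ * β * γ'⁻¹)⁻¹ by group, γ'_inv, γ'_β, inv_inv]

/-- **The reversing automorphism `ν`** of `HW` (`chart ∘ ν = −chart`). [cite: KozmaNitzan2024, §4 p. 16 (Lemma 8)] -/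
def ν : Grp ≃* Grp := conjEquiv γ γ_mul_γ γ_gens

/-- **The axis-flipping automorphism `κ`** of `HW` (`chart ∘ κ = flipSnd ∘ chart`). [cite: KozmaNitzan2024, §4 p. 16 (Lemma 8)] -/
def κ : Grp ≃* Grp := conjEquiv γ' γ'_mul_γ' γ'_gens

end HW

end Summit.CriticalPhenomena.PercolationContinuityZ3.Theorems.Transplant

end
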